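import Literature.AnabelianGeometry.EtaleTheta.FrobenioidThetaDivisorSupportQOrders
import Literature.AnabelianGeometry.EtaleTheta.FrobenioidThetaDivisorSupportAdjacencyCount

/-!
# [EtTh] §5, Proposition 5.3 (iv) over PERFECT `Φ(A_⊚)`: the p.326 description of `Prime^csp ↠ Prime^ncsp` from the intersection theory of the chain (repair `Q`, part 1)

Mochizuki, *The étale theta function …*, Publ. RIMS **45** (2009)
[cite: MochizukiEtTh2009, Prop 5.3 proof p.326 (PDF p.100); §1 p.240 (PDF p.14)].
Seat abc-iut-L6-d1 (gen 4); proof-only port of this lineage's `FrobenioidThetaDivisorSupportIntersection.lean` (p425860,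
over the `ℤ`-reading `DivisorSupportData'`, vacuous at perfect `Φ(A_⊚)` by p436191) to the repair `Q`
(`FrobenioidThetaDivisorSupportQ.lean` / `…QOrders.lean`); the `𝔓`-level lemmas on the chain of components
(`ncspShift_*`, `cusp_ne_of_cspToNcsp_ne`, …) are REUSED from the files of record (structure-independent).
WHAT IS PROVED: `cspToNcspCriterionQ_of_degree` — "the natural surjection of (iv) is obtained by mapping the prime
determined by `a` to the prime determined by `n`" from the "principal ⇒ degrees vanish" half of the binder (multiplicities
of `a`, `n` are now positive RATIONALS; only their sign enters); `cspToNcspWitnessedQ_of_principalIffIntegralDegreeZero`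
— the configuration of p.326 exists at every cusp (`a = 2·𝔞`, `b = 𝔠₁ + 𝔠₂`, `n = n_j`: an INTEGRAL element of
degree `0` everywhere, hence principal by the binder).
HONEST FRAMING: implications between predicates on OUR typed data; the binder `PrincipalIffIntegralDegreeZero` is
discharged by nobody here; no side taken on anything downstream; typed ≠ proved for the genuine curve. -/

namespace Literature.AnabelianGeometry.EtaleTheta

open CategoryTheory
open Literature.AlgebraicGeometry.Frobenioids

universe w v v' u u'

namespace FrobenioidThetaDivisors

open scoped Classical

variable {C : Type u} [Category.{v} C] {D : Type u'} [Category.{v'} D] {𝔉 : ThetaFrobenioid.{w} C D}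
variable {𝔓 : DivisorPrimeData 𝔉}

namespace DivisorSupportDataQ


/-! ### Degrees of prime log-divisors -/

/-- Degree on `𝔪` of a cuspidal element with a single coordinate `m` at the cusp `𝔞`: `m·[𝔞 ↦ 𝔪]`.
[cite: MochizukiEtTh2009, §1 p.240 (PDF p.14)] -/
theorem degOn_cusp (𝔖 : DivisorSupportDataQ 𝔓) (𝔪 : {p : Primes 𝔉.PhiAcirc // ¬ 𝔓.IsCuspidal p}) {𝔞 : Primes 𝔉.PhiAcirc} (h𝔞 : 𝔓.IsCuspidal 𝔞)
    {x : Algebra.GrothendieckGroup 𝔉.PhiAcirc} {m : ℚ}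
    (hx𝔞 : 𝔖.ord 𝔞 x = m) (hx : ∀ 𝔮, 𝔮 ≠ 𝔞 → 𝔖.ord 𝔮 x = 0) :
    𝔖.degOn 𝔪 x = m * (if 𝔪 = 𝔓.cspToNcsp ⟨𝔞, h𝔞⟩ then 1 else 0) := by
  have hcusp : 𝔖.IsCuspidalGp x := by
    intro 𝔭 h𝔭
    have h𝔭' : 𝔖.ord 𝔭 x ≠ 0 := (𝔖.mem_supp_iff 𝔭 x).mp h𝔭
    by_contra h; exact h𝔭' (hx 𝔭 fun h' => h (h' ▸ h𝔞))
  rw [degOn_eq, 𝔖.vert_eq_zero_of_isCuspidalGp 𝔪 hcusp, 𝔖.cuspSum_of_cusp 𝔪 h𝔞 hx𝔞 hx, zero_add,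
    mul_boole]
  rcases eq_or_ne 𝔪 (𝔓.cspToNcsp ⟨𝔞, h𝔞⟩) with h | h
  · rw [if_pos h, if_pos h.symm]
  · rw [if_neg h, if_neg (Ne.symm h)]

/-- Degree on `𝔪` of an element with a single NON-cuspidal coordinate `k` at the component `𝔫`:
`k·([𝔪 = 𝔫⁺] − 2[𝔪 = 𝔫] + [𝔪 = 𝔫⁻])`. [cite: MochizukiEtTh2009, §1 p.240 (PDF p.14)] -/
theorem degOn_ncsp (𝔖 : DivisorSupportDataQ 𝔓) (𝔪 𝔫 : {p : Primes 𝔉.PhiAcirc // ¬ 𝔓.IsCuspidal p}) {x : Algebra.GrothendieckGroup 𝔉.PhiAcirc} {k : ℚ}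
    (hx𝔫 : 𝔖.ord 𝔫.1 x = k) (hx : ∀ 𝔮, 𝔮 ≠ 𝔫.1 → 𝔖.ord 𝔮 x = 0) :
    𝔖.degOn 𝔪 x = k * ((if 𝔪 = ncspShift 𝔓 1 𝔫 then 1 else 0) - 2 * (if 𝔪 = 𝔫 then 1 else 0) +
      (if 𝔪 = ncspShift 𝔓 (-1) 𝔫 then 1 else 0)) := by
  rw [degOn_eq, 𝔖.vert_of_single 𝔪 hx𝔫 hx, 𝔖.cuspSum_eq_zero_of_forall 𝔪, add_zero]
  · have e1 : ((ncspShift 𝔓 (-1) 𝔪).1 = 𝔫.1) = (𝔪 = ncspShift 𝔓 1 𝔫) := by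
      rw [← Subtype.ext_iff, ncspShift_eq_iff, neg_neg]
    have e2 : (𝔪.1 = 𝔫.1) = (𝔪 = 𝔫) := by rw [← Subtype.ext_iff]
    have e3 : ((ncspShift 𝔓 1 𝔪).1 = 𝔫.1) = (𝔪 = ncspShift 𝔓 (-1) 𝔫) := by
      rw [← Subtype.ext_iff, ncspShift_eq_iff]
    simp only [e1, e2, e3]
  · intro 𝔠 h𝔠; exact hx 𝔠 fun h => 𝔫.2 (h ▸ h𝔠)

/-- Degree of the prime log-divisor of a cusp. [cite: MochizukiEtTh2009, §1 p.240 (PDF p.14)] -/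
theorem degOn_gen_cusp (𝔖 : DivisorSupportDataQ 𝔓) (𝔪 : {p : Primes 𝔉.PhiAcirc // ¬ 𝔓.IsCuspidal p})
    (𝔠 : {p : Primes 𝔉.PhiAcirc // 𝔓.IsCuspidal p}) :
    𝔖.degOn 𝔪 (Algebra.GrothendieckGroup.of (𝔖.gen 𝔠.1)) = if 𝔪 = 𝔓.cspToNcsp 𝔠 then 1 else 0 := by
  rw [𝔖.degOn_cusp 𝔪 𝔠.2 (𝔖.ord_gen_self 𝔠.1) (fun 𝔮 h => 𝔖.ord_gen_of_ne h), one_mul]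

/-- Degree of the prime log-divisor of a component. [cite: MochizukiEtTh2009, §1 p.240 (PDF p.14)] -/
theorem degOn_gen_ncsp (𝔖 : DivisorSupportDataQ 𝔓) (𝔪 𝔫 : {p : Primes 𝔉.PhiAcirc // ¬ 𝔓.IsCuspidal p}) :
    𝔖.degOn 𝔪 (Algebra.GrothendieckGroup.of (𝔖.gen 𝔫.1)) =
      (if 𝔪 = ncspShift 𝔓 1 𝔫 then 1 else 0) - 2 * (if 𝔪 = 𝔫 then 1 else 0) +
        (if 𝔪 = ncspShift 𝔓 (-1) 𝔫 then 1 else 0) := by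
  rw [𝔖.degOn_ncsp 𝔪 𝔫 (𝔖.ord_gen_self 𝔫.1) (fun 𝔮 h => 𝔖.ord_gen_of_ne h), one_mul]

/-- The support of `of (gen 𝔭)` is finite. [cite: MochizukiEtTh2009, Prop 5.3 p.325 (PDF p.99)] -/
theorem supp_gen_finite (𝔖 : DivisorSupportDataQ 𝔓) (𝔭 : Primes 𝔉.PhiAcirc) :
    (𝔖.supp (Algebra.GrothendieckGroup.of (𝔖.gen 𝔭))).Finite := by
  rw [supp_gen]; exact Set.finite_singleton _

/-- The support of a primary element is finite. [cite: MochizukiEtTh2009, Prop 5.3 p.325 (PDF p.99)] -/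
theorem supp_finite_of_mem_carrier (𝔖 : DivisorSupportDataQ 𝔓) {𝔭 : Primes 𝔉.PhiAcirc} {a : 𝔉.PhiAcirc} (ha : a ∈ 𝔭.carrier) :
    (𝔖.supp (Algebra.GrothendieckGroup.of a)).Finite := by
  rw [𝔖.supp_of_mem_carrier ha]; exact Set.finite_singleton _

/-- A non-zero cusp sum exhibits a cusp of the support over the component.
[cite: MochizukiEtTh2009, Prop 5.3 proof p.326 (PDF p.100)] -/
theorem exists_cusp_of_cuspSum_ne_zero (𝔖 : DivisorSupportDataQ 𝔓) (𝔪 : {p : Primes 𝔉.PhiAcirc // ¬ 𝔓.IsCuspidal p}) {x : Algebra.GrothendieckGroup 𝔉.PhiAcirc}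
    (h : (∑ᶠ 𝔠 : {𝔠 : {p : Primes 𝔉.PhiAcirc // 𝔓.IsCuspidal p} // 𝔓.cspToNcsp 𝔠 = 𝔪}, 𝔖.ord 𝔠.1.1 x) ≠ 0) :
    ∃ 𝔠 : {p : Primes 𝔉.PhiAcirc // 𝔓.IsCuspidal p}, 𝔓.cspToNcsp 𝔠 = 𝔪 ∧ 𝔠.1 ∈ 𝔖.supp x := by
  by_contra h'
  push Not at h'
  apply h
  apply finsum_eq_zero_of_forall_eq_zero
  intro 𝔠
  have := h' 𝔠.1 𝔠.2
  rwa [mem_supp_iff, not_not] at this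

/-! ### (iv): the description of the surjection, from "principal ⇒ degrees vanish" -/

/-- **[EtTh] Prop. 5.3 (iv), p.326 description of `Prime^csp ↠ Prime^ncsp`, from the intersection theory of the
chain**: if every principal element of `Φ(A_⊚)^gp` has degree `0` on every component, then `CspToNcspCriterion'`
holds — "the natural surjection of (iv) is obtained by mapping the prime determined by `a` to the prime
determined by `n`".  [cite: MochizukiEtTh2009, Prop 5.3 proof p.326 (PDF p.100); §1 p.240 (PDF p.14)] -/
theorem cspToNcspCriterionQ_of_degree (𝔖 : DivisorSupportDataQ 𝔓)
    (hP : ∀ x : Algebra.GrothendieckGroup 𝔉.PhiAcirc, 𝔖.IsPrincipal x → ∀ 𝔪, 𝔖.degOn 𝔪 x = 0) :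
    CspToNcspCriterionQ 𝔖 := by
  intro 𝔞 𝔫 h𝔞 h𝔫 a b n ha hn hb hcop hmin hlin
  obtain ⟨hm, hma'⟩ := 𝔖.ord_of_mem_carrier ha
  obtain ⟨hk, hkn'⟩ := 𝔖.ord_of_mem_carrier hn
  set A := Algebra.GrothendieckGroup.of a with hA
  set B := Algebra.GrothendieckGroup.of b with hB
  set N := Algebra.GrothendieckGroup.of n with hN
  have hfinA : (𝔖.supp A).Finite := 𝔖.supp_finite_of_mem_carrier ha
  have hfinN : (𝔖.supp N).Finite := 𝔖.supp_finite_of_mem_carrier hn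
  have hfinB : (𝔖.supp B).Finite := hmin.2.1.subset (𝔖.supp_subset_of_coprime hcop)
  have hx : 𝔖.IsPrincipal (B * A⁻¹ * N⁻¹) := (𝔖.isPrincipal_iff_mem _).mpr hlin
  have h0 := hP _ hx ⟨𝔫, h𝔫⟩
  rw [𝔖.degOn_mul _ (hmin.2.1) (by rw [supp_inv]; exact hfinN), 𝔖.degOn_mul _ hfinB (by rwa [supp_inv]),
    degOn_inv, degOn_inv, 𝔖.degOn_cusp ⟨𝔫, h𝔫⟩ h𝔞 rfl hma',
    𝔖.degOn_ncsp ⟨𝔫, h𝔫⟩ ⟨𝔫, h𝔫⟩ rfl hkn', degOn_eq, 𝔖.vert_eq_zero_of_isCuspidalGp _ hb, zero_add,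
    if_neg (ncspShift_ne_self one_ne_zero ⟨𝔫, h𝔫⟩).symm,
    if_neg (ncspShift_ne_self (by norm_num : (-1 : ℤ) ≠ 0) ⟨𝔫, h𝔫⟩).symm, if_pos rfl] at h0
  by_contra hne
  rw [if_neg (Ne.symm hne)] at h0
  have hB0 := 𝔖.cuspSum_of_nonneg ⟨𝔫, h𝔫⟩ b
  rw [← hB] at hB0
  linarith

/-! ### (iv): the configuration exists at every cusp, from "principal ⇔ degrees vanish" -/

/-- **[EtTh] Prop. 5.3 (iv), the p.326 configuration exists at every cusp, from the intersection theory of the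
chain**: under `PrincipalIffDegreeZero`, `CspToNcspWitnessed'` holds — at a cusp `𝔞` over the component
`n_j` take `a = 2·𝔞`, `b = 𝔠₁ + 𝔠₂` with `𝔠₁ ↦ n_{j−1}`, `𝔠₂ ↦ n_{j+1}`, `n = n_j`.
[cite: MochizukiEtTh2009, Prop 5.3 proof p.326 (PDF p.100); §1 p.240 (PDF p.14)] -/
theorem cspToNcspWitnessedQ_of_principalIffIntegralDegreeZero (𝔖 : DivisorSupportDataQ 𝔓) (hI : 𝔖.PrincipalIffIntegralDegreeZero) :
    CspToNcspWitnessedQ 𝔖 := by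
  intro 𝔞 h𝔞
  set 𝔫 : {p : Primes 𝔉.PhiAcirc // ¬ 𝔓.IsCuspidal p} := 𝔓.cspToNcsp ⟨𝔞, h𝔞⟩ with h𝔫def
  set 𝔫p : {p : Primes 𝔉.PhiAcirc // ¬ 𝔓.IsCuspidal p} := ncspShift 𝔓 1 𝔫 with h𝔫p
  set 𝔫m : {p : Primes 𝔉.PhiAcirc // ¬ 𝔓.IsCuspidal p} := ncspShift 𝔓 (-1) 𝔫 with h𝔫m
  obtain ⟨𝔠₁, h𝔠₁⟩ := 𝔓.cspToNcsp_surjective 𝔫m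
  obtain ⟨𝔠₂, h𝔠₂⟩ := 𝔓.cspToNcsp_surjective 𝔫p
  have hpn : 𝔫p ≠ 𝔫 := ncspShift_ne_self one_ne_zero 𝔫
  have hmn : 𝔫m ≠ 𝔫 := ncspShift_ne_self (by norm_num) 𝔫
  have hpm : 𝔫p ≠ 𝔫m := ncspShift_ne_ncspShift (by norm_num) 𝔫
  have h𝔠₁𝔞 : 𝔠₁.1 ≠ 𝔞 := fun h =>
    hmn (by rw [← h𝔠₁, h𝔫def]; congr 1; exact Subtype.ext h)
  have h𝔠₂𝔞 : 𝔠₂.1 ≠ 𝔞 := fun h =>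
    hpn (by rw [← h𝔠₂, h𝔫def]; congr 1; exact Subtype.ext h)
  have h𝔠₁𝔠₂ : 𝔠₁.1 ≠ 𝔠₂.1 := cusp_ne_of_cspToNcsp_ne (by rw [h𝔠₁, h𝔠₂]; exact hpm.symm)
  -- the elements
  set A := Algebra.GrothendieckGroup.of (𝔖.gen 𝔞 ^ 2) with hA
  set G₁ := Algebra.GrothendieckGroup.of (𝔖.gen 𝔠₁.1) with hG₁
  set G₂ := Algebra.GrothendieckGroup.of (𝔖.gen 𝔠₂.1) with hG₂
  set N := Algebra.GrothendieckGroup.of (𝔖.gen 𝔫.1) with hN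
  have hB : Algebra.GrothendieckGroup.of (𝔖.gen 𝔠₁.1 * 𝔖.gen 𝔠₂.1) = G₁ * G₂ := map_mul _ _ _
  have ha : 𝔖.gen 𝔞 ^ 2 ∈ 𝔞.carrier := 𝔖.gen_pow_mem_carrier 𝔞 two_pos
  have hn : 𝔖.gen 𝔫.1 ∈ 𝔫.1.carrier := 𝔖.gen_mem_carrier _
  -- supports
  have hsA : 𝔖.supp A = {𝔞} := 𝔖.supp_of_mem_carrier ha
  have hsB : 𝔖.supp (G₁ * G₂) ⊆ {𝔠₁.1, 𝔠₂.1} := by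
    refine (𝔖.supp_mul_subset _ _).trans ?_
    rw [hG₁, hG₂, supp_gen, supp_gen]
    intro 𝔭 h; simpa [or_comm] using h
  have hfinA : (𝔖.supp A).Finite := by rw [hsA]; exact Set.finite_singleton _
  have hfinG₁ : (𝔖.supp G₁).Finite := 𝔖.supp_gen_finite _
  have hfinG₂ : (𝔖.supp G₂).Finite := 𝔖.supp_gen_finite _
  have hfinB : (𝔖.supp (G₁ * G₂)).Finite := (Set.toFinite _).subset hsB
  have hfinN : (𝔖.supp N).Finite := 𝔖.supp_gen_finite _
  have hfinBA : (𝔖.supp (G₁ * G₂ * A⁻¹)).Finite :=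
    ((hfinB.union (by rwa [supp_inv] : (𝔖.supp A⁻¹).Finite))).subset (𝔖.supp_mul_subset _ _)
  have hcuspB : 𝔖.IsCuspidalGp (G₁ * G₂) := by
    intro 𝔭 h𝔭
    rcases hsB h𝔭 with h | h
    · rw [h]; exact 𝔠₁.2
    · rw [Set.mem_singleton_iff] at h; rw [h]; exact 𝔠₂.2
  have hcuspBA : 𝔖.IsCuspidalGp (G₁ * G₂ * A⁻¹) := by
    intro 𝔭 h𝔭
    rcases 𝔖.supp_mul_subset _ _ h𝔭 with h | h
    · exact hcuspB 𝔭 h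
    · rw [supp_inv, hsA, Set.mem_singleton_iff] at h; rw [h]; exact h𝔞
  -- degrees: `G₁ + G₂ − A − N` has degree 0 on every component
  have hdeg : ∀ 𝔪 : {p : Primes 𝔉.PhiAcirc // ¬ 𝔓.IsCuspidal p},
      𝔖.degOn 𝔪 (G₁ * G₂ * A⁻¹ * N⁻¹) = 0 := by
    intro 𝔪
    rw [𝔖.degOn_mul _ hfinBA (by rwa [supp_inv]), 𝔖.degOn_mul _ hfinB (by rwa [supp_inv]),
      𝔖.degOn_mul _ hfinG₁ hfinG₂, degOn_inv, degOn_inv, 𝔖.degOn_gen_cusp, 𝔖.degOn_gen_cusp, h𝔠₁, h𝔠₂,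
      𝔖.degOn_cusp 𝔪 h𝔞 (by rw [hA, map_pow, ord_pow, ord_gen_self])
        (fun 𝔮 h => by rw [hA, map_pow, ord_pow, 𝔖.ord_gen_of_ne h, mul_zero]),
      ← h𝔫def, 𝔖.degOn_gen_ncsp 𝔪 𝔫]
    ring
  -- integrality: `G₁ + G₂ − A − N` has integer coordinates
  have hint : 𝔖.Integral (G₁ * G₂ * A⁻¹ * N⁻¹) :=
    𝔖.integral_mul (𝔖.integral_mul (𝔖.integral_mul (𝔖.integral_of_gen _) (𝔖.integral_of_gen _))
      (𝔖.integral_inv (by rw [hA, map_pow]; exact 𝔖.integral_pow (𝔖.integral_of_gen 𝔞) 2)))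
      (𝔖.integral_inv (𝔖.integral_of_gen _))
  have hlinN : 𝔖.LinEquiv (G₁ * G₂ * A⁻¹) N := by
    change G₁ * G₂ * A⁻¹ * N⁻¹ ∈ 𝔖.principal
    exact (𝔖.isPrincipal_iff_mem _).mp ((hI _).mpr ⟨hint, hdeg⟩)
  refine ⟨𝔫.1, 𝔫.2, 𝔖.gen 𝔞 ^ 2, 𝔖.gen 𝔠₁.1 * 𝔖.gen 𝔠₂.1, 𝔖.gen 𝔫.1, ha, hn, ?_, ?_, ?_, ?_⟩
  · rw [hB]; exact hcuspB
  · -- coprime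
    change Disjoint (𝔖.supp A) (𝔖.supp (Algebra.GrothendieckGroup.of (𝔖.gen 𝔠₁.1 * 𝔖.gen 𝔠₂.1)))
    rw [hB, hsA, Set.disjoint_singleton_left]
    intro h
    rcases hsB h with h | h
    · exact h𝔠₁𝔞 h.symm
    · exact h𝔠₂𝔞 (Set.mem_singleton_iff.mp h).symm
  · -- cuspidally minimal
    rw [hB]
    refine ⟨hcuspBA, hfinBA, fun y hy hyfin hylin => ?_⟩
    -- `supp (G₁ G₂ A⁻¹)` has at most three elements
    have hle3 : (𝔖.supp (G₁ * G₂ * A⁻¹)).ncard ≤ 3 := by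
      have hsub : 𝔖.supp (G₁ * G₂ * A⁻¹) ⊆ {𝔠₁.1, 𝔠₂.1, 𝔞} := by
        intro 𝔭 h𝔭
        rcases 𝔖.supp_mul_subset _ _ h𝔭 with h | h
        · rcases hsB h with h | h
          · exact Or.inl h
          · exact Or.inr (Or.inl (Set.mem_singleton_iff.mp h))
        · rw [supp_inv, hsA] at h; exact Or.inr (Or.inr h)
      refine (Set.ncard_le_ncard hsub (Set.toFinite _)).trans ?_
      refine (Set.ncard_insert_le _ _).trans ?_
      have := Set.ncard_insert_le 𝔠₂.1 ({𝔞} : Set (Primes 𝔉.PhiAcirc))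
      rw [Set.ncard_singleton] at this
      omega
    -- any cuspidal `y ∼ G₁ G₂ A⁻¹ ∼ N` has a cusp over each of `𝔫m, 𝔫, 𝔫p` in its support
    have hyN : 𝔖.IsPrincipal (y * N⁻¹) := by
      rw [isPrincipal_iff_mem]
      have h1 : y * (G₁ * G₂ * A⁻¹)⁻¹ ∈ 𝔖.principal := hylin
      have h2 : G₁ * G₂ * A⁻¹ * N⁻¹ ∈ 𝔖.principal := hlinN
      have := 𝔖.principal.mul_mem h1 h2
      convert this using 1; group
    have hdegy : ∀ 𝔪 : {p : Primes 𝔉.PhiAcirc // ¬ 𝔓.IsCuspidal p},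
        (∑ᶠ 𝔠 : {𝔠 : {p : Primes 𝔉.PhiAcirc // 𝔓.IsCuspidal p} // 𝔓.cspToNcsp 𝔠 = 𝔪}, 𝔖.ord 𝔠.1.1 y) =
        (if 𝔪 = 𝔫p then 1 else 0) - 2 * (if 𝔪 = 𝔫 then 1 else 0) + (if 𝔪 = 𝔫m then 1 else 0) := by
      intro 𝔪
      have h0 := ((hI _).mp hyN).2 𝔪
      rw [𝔖.degOn_mul _ hyfin (by rwa [supp_inv]), degOn_inv, 𝔖.degOn_gen_ncsp 𝔪 𝔫, degOn_eq,
        𝔖.vert_eq_zero_of_isCuspidalGp _ hy, zero_add] at h0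
      linarith
    have hc0 :
        (∑ᶠ 𝔠 : {𝔠 : {p : Primes 𝔉.PhiAcirc // 𝔓.IsCuspidal p} // 𝔓.cspToNcsp 𝔠 = 𝔫}, 𝔖.ord 𝔠.1.1 y) ≠ 0 := by
      rw [hdegy, if_neg hpn.symm, if_pos rfl, if_neg hmn.symm]; norm_num
    have hcp :
        (∑ᶠ 𝔠 : {𝔠 : {p : Primes 𝔉.PhiAcirc // 𝔓.IsCuspidal p} // 𝔓.cspToNcsp 𝔠 = 𝔫p}, 𝔖.ord 𝔠.1.1 y) ≠ 0 := by
      rw [hdegy, if_pos rfl, if_neg hpn, if_neg hpm]; norm_num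
    have hcm :
        (∑ᶠ 𝔠 : {𝔠 : {p : Primes 𝔉.PhiAcirc // 𝔓.IsCuspidal p} // 𝔓.cspToNcsp 𝔠 = 𝔫m}, 𝔖.ord 𝔠.1.1 y) ≠ 0 := by
      rw [hdegy, if_neg hpm.symm, if_neg hmn, if_pos rfl]; norm_num
    obtain ⟨𝔡₀, h𝔡₀, h𝔡₀y⟩ := 𝔖.exists_cusp_of_cuspSum_ne_zero _ hc0
    obtain ⟨𝔡p, h𝔡p, h𝔡py⟩ := 𝔖.exists_cusp_of_cuspSum_ne_zero _ hcp
    obtain ⟨𝔡m, h𝔡m, h𝔡my⟩ := 𝔖.exists_cusp_of_cuspSum_ne_zero _ hcm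
    have h3 : ({𝔡₀.1, 𝔡p.1, 𝔡m.1} : Set (Primes 𝔉.PhiAcirc)).ncard = 3 := by
      rw [Set.ncard_eq_three]
      exact ⟨𝔡₀.1, 𝔡p.1, 𝔡m.1, cusp_ne_of_cspToNcsp_ne (by rw [h𝔡₀, h𝔡p]; exact hpn.symm),
        cusp_ne_of_cspToNcsp_ne (by rw [h𝔡₀, h𝔡m]; exact hmn.symm),
        cusp_ne_of_cspToNcsp_ne (by rw [h𝔡p, h𝔡m]; exact hpm), rfl⟩
    have hsub : ({𝔡₀.1, 𝔡p.1, 𝔡m.1} : Set (Primes 𝔉.PhiAcirc)) ⊆ 𝔖.supp y := by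
      intro 𝔭 h
      rcases h with h | h | h
      · rw [h]; exact h𝔡₀y
      · rw [h]; exact h𝔡py
      · rw [Set.mem_singleton_iff] at h; rw [h]; exact h𝔡my
    have := Set.ncard_le_ncard hsub hyfin
    change (𝔖.supp (G₁ * G₂ * A⁻¹)).ncard ≤ (𝔖.supp y).ncard
    omega
  · rw [hB]; exact hlinN

end DivisorSupportDataQ

end FrobenioidThetaDivisors

end Literature.AnabelianGeometry.EtaleTheta
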